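import Literature.NumberTheory.Automorphic.PairLFunctionNeConjLevelOneOfArch
import Literature.NumberTheory.Automorphic.ArchRankinSelbergPairBridgeTranslate
import Literature.NumberTheory.Automorphic.PairLFunctionMeromorphicContinuationNeConjLocalDataTranslate
import Literature.NumberTheory.Automorphic.WhittakerShiftTorus
import Literature.NumberTheory.Automorphic.WhittakerCoeffLevelOneTranslateNonvanishing
import Literature.NumberTheory.Automorphic.CornerTorusIwasawaData
import HarnessLib

/-!
# Mœglin–Waldspurger (i)(b) for everywhere-unramified level-one pairs over EVERY number field, from the
archimedean local theory

Topic `NumberTheory/Automorphic`; namespace `Literature.NumberTheory.Automorphic`. Theorems only (no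
definition, no named fact). `exists_entire_eq_partialPairL_of_levelOne_of_archPairLFactorData`
(`PairLFunctionNeConjLevelOneOfArch`) derives the conclusion of the named fact
`MoeglinWaldspurger1989_partialPairL_entire_of_ne_conj` for level-one pairs from the archimedean
hypothesis `hX`, over a number field with TRIVIAL different (`𝔡_K = 1`, i.e. `K = ℚ`): only then is
Tate's character unramified at every finite place, so that the unit-box part of the unfolded global
integral is archimedean. This file removes the hypothesis on the different
(`exists_entire_eq_partialPairL_of_levelOne_of_archPairLFactorData'`). At a place `v ∣ 𝔡_K`, where
`ψ_{K,v}` has conductor `ϖ_v^{-e_v} 𝒪_v`, the unramified computation holds after translating by the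
Whittaker shift `t_{e_v} = diag(ϖ_v^{-e_v(n-1)}, …, ϖ_v^{-e_v}, 1)` (Cogdell (2004), §3.1); globally one
translates by the torus element `τ` of all shifts (`exists_whittakerShiftTorus`), a finite-adelic
element `T = (1, T_f)`:

* the global side is `exists_entire_eq_partialPairL_of_localData_translate` with `S'_i = ∅`, `𝔫_i = 1`,
  `c_i = 1`, `B = Λ`, whose `S'`-parts are the unit-box integrals of the TRANSLATED Whittaker
  coefficients `W_{S_η f}(T ·)`;
* these are archimedean local integrals of the archimedean components `τ_∞`, `τ'_∞`
  (`ArchRankinSelbergPairBridgeTranslate`), for the decomposition of the level-`U_T` piece,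
  `U_T = T_f GL_n(𝒪̂) T_f⁻¹`, and the vectors `e_i = S_i† R(T) R(η) f`;
* some transferred Whittaker functional at level `U_T` is non-zero
  (`exists_transferMap_ne_zero_of_levelOne_translate`, from the non-vanishing `W_{S_η f₀}(T g) ≠ 0` of
  `WhittakerCoeffLevelOneTranslateNonvanishing`);
* a `K_∞`-finite Gårding datum `x` of `τ_∞` in the copy `S_{i₀}` is realised by the LEVEL-ONE vector
  `f = R(T)⁻¹ S_{i₀} x` smoothed by ONE level-one test function for the pair
  (`exists_testFunctionGL_smoothedVector_eq_pair` at level `K(1)`), since `R(T) R(η) f = R(T) f = S_{i₀} x`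
  (`exists_testFunctionGL_setIntegral_unitBox_translate_eq_archRankinSelbergPairIntegral`).

## Main statements

* `exists_transferMap_ne_zero_of_levelOne_translate`,
  `exists_testFunctionGL_setIntegral_unitBox_translate_eq_archRankinSelbergPairIntegral`;
* `exists_entire_eq_partialPairL_of_levelOne_of_archPairLFactorData'` (**main**): under `hX`, for
  `0 < n`, multiplicity one on `L²_cusp`, ANY number field `K`, and cuspidal `π ≠ σ̄` on `GL_n(𝔸_K)` with
  `K(1)`-fixed Hecke eigenvectors at every finite place, `L^S(s, π × σ)` extends to an entire function
  for every finite `S`.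

## References

* C. Mœglin, J.-L. Waldspurger, *Le spectre résiduel de GL(n)*, Ann. Sci. ÉNS 22 (1989), Appendice,
  Corollaire (i)(b), p. 667 [MoeglinWaldspurger1989].
* J. W. Cogdell, *Analytic theory of L-functions for GL_n*, in *An Introduction to the Langlands
  Program* (2004), §3.1–§3.2, §4.1–§4.2 [CogdellAnalyticTheory2004].
* H. Jacquet, J. A. Shalika, *Rankin–Selberg convolutions: Archimedean theory* (1990), §1
  [JacquetShalikaArchimedean1990].
* H. Jacquet, *Archimedean Rankin–Selberg integrals*, Contemp. Math. 489 (2009), Thm. 2.1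
  [JacquetArchimedeanRS2009].
-/

noncomputable section

open MeasureTheory Measure NumberField NumberField.mixedEmbedding IsDedekindDomain Set Filter
open Literature.NumberTheory.GaloisRepresentations (ideleGroup)
open scoped MatrixGroups ENNReal NNReal Classical ComplexConjugate

namespace Literature.NumberTheory.Automorphic

-- the automorphic quotient carries the tree's Borel σ-algebra, not Mathlib's quotient σ-algebra
attribute [-instance] Quotient.instMeasurableSpace QuotientGroup.measurableSpace

variable {n : ℕ} {K : Type} [Field K] [NumberField K]
variable {μ' : Measure (AdelicGroupData.gl n K).automorphicQuotient} [(AdelicGroupData.gl n K).IsAutomorphicMeasure μ']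

attribute [local instance] adelicBorel borelSpace_adelic locallyCompactSpace_adelic secondCountableTopology_gl_adelic
  glAdeleBorel borelSpace_glAdele borelSpace_ideleGroup secondCountableTopology_ideleGroup

attribute [local instance] Literature.MeasureTheory.Group.hasSummableGeomSeries_of_finiteDimensional
  Literature.MeasureTheory.Group.Units.borelSpace_of_isOpenEmbedding
  Literature.MeasureTheory.Group.Units.secondCountableTopology
  Literature.MeasureTheory.Group.Units.locallyCompactSpace

attribute [local instance] borelSpace_pi_mixedUnits measurableMul_pi_mixedUnits

/-! ### The finite-adelic translation and the conjugate level -/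

/-- A torus element with trivial archimedean components is finite-adelic: `diag(ι(τ_f)) = (1, diag(τ_f))`.
[folklore] -/
theorem glDiagonal_unitsMap_inr_eq_ofFinite (τf : Fin n → (FiniteAdeleRing (𝓞 K) K)ˣ) :
    glDiagonal n (AdeleRing (𝓞 K) K) (fun i =>
        Units.map (MonoidHom.inr (InfiniteAdeleRing K) (FiniteAdeleRing (𝓞 K) K) :
          FiniteAdeleRing (𝓞 K) K →* AdeleRing (𝓞 K) K) (τf i)) =
      GLn.ofFinite n K (glDiagonal n (FiniteAdeleRing (𝓞 K) K) τf) := by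
  refine GLn.ext_of_fstHom_of_sndHom ?_ ?_
  · rw [GLn.fstHom_ofFinite]
    change Matrix.GeneralLinearGroup.map _ _ = 1
    refine (generalLinearGroup_map_glDiagonal _ _).trans ?_
    convert map_one (glDiagonal n (InfiniteAdeleRing K)) using 2
    funext i
    exact Units.ext rfl
  · rw [GLn.sndHom_ofFinite]
    change Matrix.GeneralLinearGroup.map _ _ = _
    exact (generalLinearGroup_map_glDiagonal _ _).trans rfl

/-- **The conjugate level `U_T = T_f GL_n(𝒪̂) T_f⁻¹` is compact open**, and `T_f⁻¹ u T_f ∈ GL_n(𝒪̂)` for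
`u ∈ U_T`. [folklore] -/
theorem conjLevel_isOpen_isCompact (hcpt : isCompact_glFiniteIntegralLevel n K)
    (Tf : GL (Fin n) (FiniteAdeleRing (𝓞 K) K)) :
    IsOpen (((glFiniteIntegralLevel n K).map (MulAut.conj Tf).toMonoidHom :
        Subgroup (GL (Fin n) (FiniteAdeleRing (𝓞 K) K))) : Set (GL (Fin n) (FiniteAdeleRing (𝓞 K) K))) ∧
      IsCompact (((glFiniteIntegralLevel n K).map (MulAut.conj Tf).toMonoidHom :
        Subgroup (GL (Fin n) (FiniteAdeleRing (𝓞 K) K))) : Set (GL (Fin n) (FiniteAdeleRing (𝓞 K) K))) ∧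
      ∀ u ∈ (glFiniteIntegralLevel n K).map (MulAut.conj Tf).toMonoidHom,
        Tf⁻¹ * u * Tf ∈ glFiniteIntegralLevel n K := by
  refine ⟨?_, ?_, ?_⟩
  · rw [Subgroup.map_equiv_eq_comap_symm']
    change IsOpen ((fun x => (MulAut.conj Tf).symm.toMonoidHom x) ⁻¹' (glFiniteIntegralLevel n K : Set _))
    refine (isOpen_glFiniteIntegralLevel n K).preimage ?_
    change Continuous fun x => (MulAut.conj Tf).symm x
    simp only [MulAut.conj_symm_apply]
    exact (continuous_const.mul continuous_id).mul continuous_const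
  · rw [Subgroup.coe_map]
    refine hcpt.image ?_
    change Continuous fun x => MulAut.conj Tf x
    simp only [MulAut.conj_apply]
    exact (continuous_const.mul continuous_id).mul continuous_const
  · rintro _ ⟨u₀, hu₀, rfl⟩
    change Tf⁻¹ * (MulAut.conj Tf u₀) * Tf ∈ _
    rw [MulAut.conj_apply, show Tf⁻¹ * (Tf * u₀ * Tf⁻¹) * Tf = u₀ by group]
    exact hu₀

/-- **`R(T)⁻¹` of a vector in the image of a level-`U_T` archimedean intertwiner is fixed by `K(1)`**
(`U_T = T_f GL_n(𝒪̂) T_f⁻¹`). [folklore] -/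
theorem toContRep_ofFinite_inv_apply_eq_self_of_mem_archIntertwinersLevel_conj {hcpt : isCompact_glFiniteIntegralLevel n K}
    (P : CuspidalAutomorphicRepGL n K μ')
    {E : Type*} [NormedAddCommGroup E] [InnerProductSpace ℂ E] [CompleteSpace E]
    {τ : ContRepresentation ℂ (AutomorphyDatum.gl n K hcpt).arch.carrier E}
    (Tf : GL (Fin n) (FiniteAdeleRing (𝓞 K) K))
    {T : E →L[ℂ] (AdelicGroupData.gl n K).L2 μ'}
    (hT : T ∈ archIntertwinersLevel hcpt τ P.1 ((glFiniteIntegralLevel n K).map (MulAut.conj Tf).toMonoidHom))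
    (x : E) : ∀ u ∈ glIntegralLevel n K,
      P.1.toContRep u (P.1.toContRep (GLn.ofFinite n K Tf⁻¹)
        ⟨T x, ContRepresentation.ClosedSubrep.mem_toSubmodule.2 (hT.1.1 x)⟩) =
        P.1.toContRep (GLn.ofFinite n K Tf⁻¹) ⟨T x, ContRepresentation.ClosedSubrep.mem_toSubmodule.2 (hT.1.1 x)⟩ := by
  intro u hu
  obtain ⟨hu', hsnd⟩ := eq_ofFinite_sndHom_of_mem_glIntegralLevel hu
  have hmul : ∀ (a b : GL (Fin n) (AdeleRing (𝓞 K) K)) (y : P.1.toSubmodule),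
      P.1.toContRep (a * b) y = P.1.toContRep a (P.1.toContRep b y) := fun a b y =>
    (DFunLike.congr_fun (map_mul P.1.toContRep a b) y).trans rfl
  -- `u T⁻¹ = T⁻¹ (T u T⁻¹)` with `T u T⁻¹ ∈ U_T`
  have hconj : GLn.ofFinite n K (GLn.sndHom n K u) * GLn.ofFinite n K Tf⁻¹ =
      GLn.ofFinite n K Tf⁻¹ * GLn.ofFinite n K (Tf * GLn.sndHom n K u * Tf⁻¹) := by
    rw [← map_mul, ← map_mul]
    congr 1
    group
  have hmem : Tf * GLn.sndHom n K u * Tf⁻¹ ∈ (glFiniteIntegralLevel n K).map (MulAut.conj Tf).toMonoidHom :=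
    ⟨GLn.sndHom n K u, hsnd, rfl⟩
  have hfix : P.1.toContRep (GLn.ofFinite n K (Tf * GLn.sndHom n K u * Tf⁻¹))
      ⟨T x, ContRepresentation.ClosedSubrep.mem_toSubmodule.2 (hT.1.1 x)⟩ =
      ⟨T x, ContRepresentation.ClosedSubrep.mem_toSubmodule.2 (hT.1.1 x)⟩ := by
    apply Subtype.ext
    rw [ContRepresentation.ClosedSubrep.coe_toContRep_apply]
    exact (mem_levelPiece_iff.1 (hT.2 x)).2 _ hmem
  rw [hu', ← hmul, hconj, hmul, hfix]

/-- **`K_∞`-finiteness is preserved by a finite-adelic right translation** (it commutes with `K_∞`).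
[folklore] -/
theorem finiteDimensional_span_toContRep_ofK_toContRep_ofFinite {hcpt : isCompact_glFiniteIntegralLevel n K}
    (P : CuspidalAutomorphicRepGL n K μ') (c : GL (Fin n) (FiniteAdeleRing (𝓞 K) K)) (y : P.1.toSubmodule)
    (hfin : FiniteDimensional ℂ (Submodule.span ℂ (Set.range
      fun k : (AutomorphyDatum.gl n K hcpt).arch.maximalCompact =>
        P.1.toContRep ((AutomorphyDatum.gl n K hcpt).ofK k) y))) :
    FiniteDimensional ℂ (Submodule.span ℂ (Set.range
      fun k : (AutomorphyDatum.gl n K hcpt).arch.maximalCompact =>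
        P.1.toContRep ((AutomorphyDatum.gl n K hcpt).ofK k) (P.1.toContRep (GLn.ofFinite n K c) y))) := by
  have hmul : ∀ (a b : GL (Fin n) (AdeleRing (𝓞 K) K)) (z : P.1.toSubmodule),
      P.1.toContRep (a * b) z = P.1.toContRep a (P.1.toContRep b z) := fun a b z =>
    (DFunLike.congr_fun (map_mul P.1.toContRep a b) z).trans rfl
  have heq : (fun k : (AutomorphyDatum.gl n K hcpt).arch.maximalCompact =>
      P.1.toContRep ((AutomorphyDatum.gl n K hcpt).ofK k) (P.1.toContRep (GLn.ofFinite n K c) y)) =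
      (P.1.toContRep (GLn.ofFinite n K c)).toLinearMap ∘ fun k : (AutomorphyDatum.gl n K hcpt).arch.maximalCompact =>
        P.1.toContRep ((AutomorphyDatum.gl n K hcpt).ofK k) y := by
    funext k
    show P.1.toContRep ((AutomorphyDatum.gl n K hcpt).ofK k) (P.1.toContRep (GLn.ofFinite n K c) y) =
      P.1.toContRep (GLn.ofFinite n K c) (P.1.toContRep ((AutomorphyDatum.gl n K hcpt).ofK k) y)
    rw [← hmul, ← hmul, AutomorphyDatum.ofK_apply, AutomorphyDatum.gl_ofArch_apply,
      (GLn.commute_ofInfinite_ofFinite _ c).eq]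
  rw [heq, Set.range_comp, Submodule.span_image]
  haveI := hfin
  exact Module.Finite.map _ _

section Main

open ValuativeRel

variable [MeasurableSpace (AdeleRing (𝓞 K) K)] [BorelSpace (AdeleRing (𝓞 K) K)]

/-- **Some transferred Whittaker functional of a level-one cuspidal `Π` at the conjugate level `U_T` is
non-zero** (any number field). With `S_1, …, S_k` decomposing the level-`U_T` piece, `U_T = T_f GL_n(𝒪̂) T_f⁻¹`,
some `Φ_ℓ(S_{i₀}) ≠ 0`: a non-zero level-one vector `f₀` smoothed by a level-one test function has
`W_{S_η f₀}(T g) ≠ 0` at some `g` with `g_f ∈ GL_n(𝒪̂)`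
(`exists_whittakerCoeff_smoothedForm_translate_ne_zero_sndHom_mem_glFiniteIntegralLevel`), so
`W_{S_η f₀}((g_∞, T_f)) ≠ 0`, where the value formula with `e_i = S_i† R(T) R(η) f₀` holds.
[cite: CogdellAnalyticTheory2004, §1.1 and §3.1 Thm. 3.3] -/
theorem exists_transferMap_ne_zero_of_levelOne_translate (hcpt : isCompact_glFiniteIntegralLevel n K) (hn : 1 ≤ n)
    (P : CuspidalAutomorphicRepGL n K μ') {α₀ : SatakeFamily K}
    (hP : ∀ v : HeightOneSpectrum (𝓞 K), ∃ ϖ : (v.adicCompletion K)ˣ,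
      HasSatakeParameterAt P.1 (glIntegralLevel n K) v ϖ (α₀ v))
    {E : Type*} [NormedAddCommGroup E] [InnerProductSpace ℂ E] [CompleteSpace E]
    {τ : ContRepresentation ℂ (AutomorphyDatum.gl n K hcpt).arch.carrier E}
    (hτu : τ.IsUnitary) (hτi : τ.IsTopIrreducible) (hτc : τ.IsStronglyContinuous)
    (hex : ∃ T ∈ archIntertwiners hcpt τ P.1, T ≠ 0)
    (τf : Fin n → (FiniteAdeleRing (𝓞 K) K)ˣ)
    (hτψ : ∀ v : HeightOneSpectrum (𝓞 K), ∃ (d : Fin n → (v.adicCompletion K)ˣ) (a : (v.adicCompletion K)ˣ),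
      localComponent v (glDiagonal n (AdeleRing (𝓞 K) K) fun i =>
          Units.map (MonoidHom.inr (InfiniteAdeleRing K) (FiniteAdeleRing (𝓞 K) K) :
            FiniteAdeleRing (𝓞 K) K →* AdeleRing (𝓞 K) K) (τf i)) =
        diagonalGL (Fin n) (v.adicCompletion K) d ∧
      (∀ i j : Fin n, (i : ℕ) + 1 = j →
        (d i : v.adicCompletion K) * ((d j)⁻¹ : (v.adicCompletion K)ˣ) = a) ∧
      (∀ c ∈ 𝒪[v.adicCompletion K], (adeleAddChar K).adicComponent v (a * c) = 1) ∧
      ∀ ϖ : v.adicCompletion K, Valued.v ϖ = WithZero.exp (-1 : ℤ) →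
        ∃ c ∈ 𝒪[v.adicCompletion K], (adeleAddChar K).adicComponent v (a * (ϖ⁻¹ * c)) ≠ 1)
    {U : Subgroup (GL (Fin n) (FiniteAdeleRing (𝓞 K) K))}
    (hUo : IsOpen (U : Set (GL (Fin n) (FiniteAdeleRing (𝓞 K) K))))
    (hUc : IsCompact (U : Set (GL (Fin n) (FiniteAdeleRing (𝓞 K) K))))
    (hTU : ∀ u ∈ U, (glDiagonal n (FiniteAdeleRing (𝓞 K) K) τf)⁻¹ * u * glDiagonal n (FiniteAdeleRing (𝓞 K) K) τf ∈
      glFiniteIntegralLevel n K)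
    {k : ℕ} {S : Fin k → E →L[ℂ] (AdelicGroupData.gl n K).L2 μ'}
    (hS : ∀ i, S i ∈ archIntertwinersLevel hcpt τ P.1 U)
    (hSon : ∀ i j, schurCoeff (μ := μ') (S i) (S j) = if i = j then 1 else 0)
    (hspan : ∀ T ∈ archIntertwinersLevel hcpt τ P.1 U, T ∈ Submodule.span ℂ (Set.range S))
    (ν₀ : Measure ↥(adelicUnipotent n K)) [IsHaarMeasure ν₀] :
    ∃ i₀ : Fin k, transferMap (whittakerFunctional ν₀ (continuous_adeleAddChar K)
        (ContRepresentation.Equiv.refl P.1.toContRep)) hτc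
        ⟨S i₀, mem_multiplicityModule_of_mem_archIntertwinersLevel hUo hUc (hS i₀)⟩ ≠ 0 := by
  classical
  set Tf : GL (Fin n) (FiniteAdeleRing (𝓞 K) K) := glDiagonal n (FiniteAdeleRing (𝓞 K) K) τf with hTf
  -- a non-zero level-one vector
  obtain ⟨v₀⟩ := (infinite_heightOneSpectrum (K := K)).nonempty
  obtain ⟨ϖ, -, -, f₀, hf₀K, hf₀0, -⟩ := hP v₀
  have hUl := glIntegralLevel_mem_finiteLevels (n := n) (K := K) hcpt
  have hUf₀ : ∀ u ∈ glIntegralLevel n K, P.1.toContRep u f₀ = f₀ :=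
    (ContRepresentation.ClosedSubrep.mem_fixedVectors _ _ _).1 hf₀K
  -- a level-one smoothing which does not kill it
  have hε : 0 < ‖f₀‖ / 2 := half_pos (norm_pos_iff.2 hf₀0)
  obtain ⟨η, hη, hηU, -, hle⟩ :=
    exists_adInvariant_isTestFunctionGL_norm_smoothedVector_sub_le hcpt P.1 hUl f₀ hUf₀ hε
  have hS0 : smoothedVector P.1 η f₀ ≠ 0 := by
    intro h0
    rw [h0, zero_sub, norm_neg] at hle
    linarith [norm_pos_iff.2 hf₀0]
  have hne0 : smoothedForm η ((f₀ : P.1.toSubmodule) : (AdelicGroupData.gl n K).L2 μ') ≠ 0 :=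
    smoothedForm_ne_zero_of_smoothedVector_ne_zero hη.continuous hη.hasCompactSupport hS0
  have hηK := left_invariant_principalCongruenceLevel_top_of_glIntegralLevel hηU
  have hleft := left_invariant_glFiniteIntegralLevel_of_glIntegralLevel (n := n) (K := K) hηU
  -- a point `g` with integral finite part where `W(T g)` does not vanish
  have hα₀ : IsSatakeFamilyOf P ∅ α₀ := IsSatakeFamilyOf.of_glIntegralLevel fun v _ => hP v
  obtain ⟨g, hgf, hWg⟩ := exists_whittakerCoeff_smoothedForm_translate_ne_zero_sndHom_mem_glFiniteIntegralLevel hn P hα₀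
    ν₀ hη hηK f₀ hne0 _ hτψ
  rw [glDiagonal_unitsMap_inr_eq_ofFinite, ← hTf] at hWg
  -- `T g = ((g_∞, T_f)) (1, g_f)`: kill `g_f` on the right
  set g' : GL (Fin n) (AdeleRing (𝓞 K) K) := GLn.ofInfinite n K (GLn.toMixed n K g) * GLn.ofFinite n K Tf with hg'
  have hdec : GLn.ofFinite n K Tf * g = g' * GLn.ofFinite n K (GLn.sndHom n K g) := by
    conv_lhs => rw [← GLn.ofInfinite_toMixed_mul_ofFinite_sndHom g]
    rw [hg', ← mul_assoc, ← (GLn.commute_ofInfinite_ofFinite (GLn.toMixed n K g) Tf).eq]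
  rw [hdec, whittakerCoeff_mul_of_forall ν₀ _ _ (fun y => invQuot_smoothedForm_mul_ofFinite_of_levelOne hηK _ hgf y) g']
    at hWg
  -- the value formula at `g' = (g_∞, T_f)`
  have hsnd : GLn.sndHom n K g' = Tf := by
    rw [hg', map_mul, GLn.sndHom_ofInfinite, one_mul, GLn.sndHom_ofFinite]
  have hleftg : ∀ u ∈ U, ∀ x : GL (Fin n) (AdeleRing (𝓞 K) K),
      η (g'⁻¹ * (GLn.ofFinite n K u * x)) = η (g'⁻¹ * x) := by
    intro u hu x
    have key : g'⁻¹ * GLn.ofFinite n K u = GLn.ofFinite n K (Tf⁻¹ * u * Tf) * g'⁻¹ := by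
      have hc' : (GLn.ofInfinite n K (GLn.toMixed n K g))⁻¹ * GLn.ofFinite n K u =
          GLn.ofFinite n K u * (GLn.ofInfinite n K (GLn.toMixed n K g))⁻¹ := by
        rw [← map_inv]; exact (GLn.commute_ofInfinite_ofFinite (GLn.toMixed n K g)⁻¹ u).eq
      rw [hg', map_mul, map_mul, map_inv, _root_.mul_inv_rev]
      conv_lhs => rw [mul_assoc, hc']
      group
    rw [← mul_assoc, key, mul_assoc, hleft _ (hTU u hu)]
  have hvT : P.1.toContRep (GLn.ofFinite n K Tf) (smoothedVector P.1 η f₀) ∈ gardingSubspace P.1 U := by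
    have hTleft : ∀ u ∈ U, ∀ x : GL (Fin n) (AdeleRing (𝓞 K) K),
        η ((GLn.ofFinite n K Tf)⁻¹ * (GLn.ofFinite n K u * x)) = η ((GLn.ofFinite n K Tf)⁻¹ * x) := by
      intro u hu x
      rw [← mul_assoc, ← map_inv, ← map_mul, show Tf⁻¹ * u = Tf⁻¹ * u * Tf * Tf⁻¹ by group, map_mul, mul_assoc,
        hleft _ (hTU u hu), map_inv]
    rw [toContRep_smoothedVector_eq _ hη.continuous hη.hasCompactSupport _ f₀]
    exact smoothedVector_mem_gardingSubspace (hη.comp_mul_left _) hTleft f₀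
  set e : Fin k → archGardingSpace hcpt τ := fun i =>
    ⟨ContinuousLinearMap.adjoint (S i) ((P.1.toContRep (GLn.ofFinite n K Tf) (smoothedVector P.1 η f₀) : P.1.toSubmodule) :
        (AdelicGroupData.gl n K).L2 μ'),
      (eq_sum_apply_of_mem_gardingSubspace P hτu hτi hτc hex hS hSon hspan hUo hUc hvT).1 i⟩
    with he_def
  have he : ∀ i, (e i : E) = ContinuousLinearMap.adjoint (S i)
      ((P.1.toContRep (GLn.ofFinite n K Tf) (smoothedVector P.1 η f₀) : P.1.toSubmodule) :
        (AdelicGroupData.gl n K).L2 μ') := fun i => rfl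
  have hW := whittakerCoeff_smoothedForm_eq_sum_transferMap_of_sndHom_eq hcpt P hτu hτi hτc hex hUo hUc hS hSon hspan ν₀
    hη f₀ hsnd hleftg e he
  rw [hW] at hWg
  obtain ⟨i₀, -, hi₀⟩ := Finset.exists_ne_zero_of_sum_ne_zero hWg
  exact ⟨i₀, fun h0 => hi₀ (by rw [h0, LinearMap.zero_apply])⟩

variable [MeasurableSpace (GL (Fin n) (mixedSpace K))] [BorelSpace (GL (Fin n) (mixedSpace K))]

set_option maxHeartbeats 1000000 in
/-- **Realisation of archimedean data by a global level-one pair, translated form.** Let `Π`, `Π'` be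
ORTHOGONAL cuspidal automorphic representations, `T = (1, T_f)`, `S`, `S'` decompositions of the
level-`U` pieces for a compact open `U` with `T_f⁻¹ U T_f ≤ GL_n(𝒪̂)` (the conjugate level
`T_f GL_n(𝒪̂) T_f⁻¹`), such that `R(T)⁻¹` of the images of the `S_i`, `S'_j` are `K(1)`-fixed, and let
`x ∈ τ`, `x' ∈ τ'` be `K_∞`-finite Gårding vectors. Then ONE level-one test function `η` fixes the
level-one vectors `f = R(T)⁻¹ S_{i₀} x`, `f' = R(T)⁻¹ S'_{j₀} x'`, and for every continuous `Φ_∞` and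
every `s` the unit-box pair integral of the translates `(W_{S_η f}(T ·), W̄_{S_η f'}(T ·), Φ_∞ ⊗ 𝟙)` is
the archimedean local integral `Ψ_∞(s; W_x, W̄'_{x'}, Φ_∞)` for `Φ_ℓ(S_{i₀})`, `Φ_ℓ(S'_{j₀})`.
[cite: CogdellAnalyticTheory2004, §4.1 and §3.1] -/
theorem exists_testFunctionGL_setIntegral_unitBox_translate_eq_archRankinSelbergPairIntegral
    (hcpt : isCompact_glFiniteIntegralLevel n K)
    (P Q : CuspidalAutomorphicRepGL n K μ') (hPQ : P.1.toSubmodule ⟂ Q.1.toSubmodule)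
    {E : Type*} [NormedAddCommGroup E] [InnerProductSpace ℂ E] [CompleteSpace E]
    {τ : ContRepresentation ℂ (AutomorphyDatum.gl n K hcpt).arch.carrier E}
    (hτu : τ.IsUnitary) (hτi : τ.IsTopIrreducible) (hτc : τ.IsStronglyContinuous)
    (hex : ∃ T ∈ archIntertwiners hcpt τ P.1, T ≠ 0)
    (Tf : GL (Fin n) (FiniteAdeleRing (𝓞 K) K))
    {U : Subgroup (GL (Fin n) (FiniteAdeleRing (𝓞 K) K))}
    (hUo : IsOpen (U : Set (GL (Fin n) (FiniteAdeleRing (𝓞 K) K))))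
    (hUc : IsCompact (U : Set (GL (Fin n) (FiniteAdeleRing (𝓞 K) K))))
    (hTU : ∀ u ∈ U, Tf⁻¹ * u * Tf ∈ glFiniteIntegralLevel n K)
    {k : ℕ} {S : Fin k → E →L[ℂ] (AdelicGroupData.gl n K).L2 μ'}
    (hS : ∀ i, S i ∈ archIntertwinersLevel hcpt τ P.1 U)
    (hSon : ∀ i j, schurCoeff (μ := μ') (S i) (S j) = if i = j then 1 else 0)
    (hspan : ∀ T ∈ archIntertwinersLevel hcpt τ P.1 U, T ∈ Submodule.span ℂ (Set.range S))
    (hSfix : ∀ i (y : E), ∀ u ∈ glIntegralLevel n K,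
      P.1.toContRep u (P.1.toContRep (GLn.ofFinite n K Tf⁻¹)
        ⟨S i y, ContRepresentation.ClosedSubrep.mem_toSubmodule.2 ((hS i).1.1 y)⟩) =
        P.1.toContRep (GLn.ofFinite n K Tf⁻¹) ⟨S i y, ContRepresentation.ClosedSubrep.mem_toSubmodule.2 ((hS i).1.1 y)⟩)
    {E' : Type*} [NormedAddCommGroup E'] [InnerProductSpace ℂ E'] [CompleteSpace E']
    {τ' : ContRepresentation ℂ (AutomorphyDatum.gl n K hcpt).arch.carrier E'}
    (hτu' : τ'.IsUnitary) (hτi' : τ'.IsTopIrreducible) (hτc' : τ'.IsStronglyContinuous)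
    (hex' : ∃ T ∈ archIntertwiners hcpt τ' Q.1, T ≠ 0)
    {k' : ℕ} {S' : Fin k' → E' →L[ℂ] (AdelicGroupData.gl n K).L2 μ'}
    (hS' : ∀ j, S' j ∈ archIntertwinersLevel hcpt τ' Q.1 U)
    (hSon' : ∀ i j, schurCoeff (μ := μ') (S' i) (S' j) = if i = j then 1 else 0)
    (hspan' : ∀ T ∈ archIntertwinersLevel hcpt τ' Q.1 U, T ∈ Submodule.span ℂ (Set.range S'))
    (hS'fix : ∀ j (y : E'), ∀ u ∈ glIntegralLevel n K,
      Q.1.toContRep u (Q.1.toContRep (GLn.ofFinite n K Tf⁻¹)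
        ⟨S' j y, ContRepresentation.ClosedSubrep.mem_toSubmodule.2 ((hS' j).1.1 y)⟩) =
        Q.1.toContRep (GLn.ofFinite n K Tf⁻¹) ⟨S' j y, ContRepresentation.ClosedSubrep.mem_toSubmodule.2 ((hS' j).1.1 y)⟩)
    (ν₀ : Measure ↥(adelicUnipotent n K)) [IsHaarMeasure ν₀]
    (i₀ : Fin k) (j₀ : Fin k') (x : archGardingSpace hcpt τ) (x' : archGardingSpace hcpt τ')
    (hxfin : FiniteDimensional ℂ (Submodule.span ℂ (Set.range
      fun κ : (AutomorphyDatum.gl n K hcpt).arch.maximalCompact => τ (toArch hcpt (κ : GL (Fin n) (mixedSpace K))) (x : E))))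
    (hx'fin : FiniteDimensional ℂ (Submodule.span ℂ (Set.range
      fun κ : (AutomorphyDatum.gl n K hcpt).arch.maximalCompact => τ' (toArch hcpt (κ : GL (Fin n) (mixedSpace K))) (x' : E'))))
    (νA : Measure (Fin n → ideleGroup K)) [IsHaarMeasure νA]
    (νK : Measure ↥(maximalCompactAdelic n K)) [IsHaarMeasure νK] :
    ∃ η : (AdelicGroupData.gl n K).Adelic → ℝ, IsTestFunctionGL n K η ∧
      (∀ c : (AdelicGroupData.gl n K).Adelic, c ∈ principalCongruenceLevel n K ⊤ →
        ∀ g : (AdelicGroupData.gl n K).Adelic, η (c * g) = η g) ∧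
      ∀ {Φinf : (Fin n → InfiniteAdeleRing K) → ℝ}, Continuous Φinf → ∀ s : ℂ,
        ∫ p in unitBox (Set.univ : Set (HeightOneSpectrum (𝓞 K))) ×ˢ Set.univ,
          torusPairIntegrandC n K
            (fun g => whittakerCoeff ν₀ (unipotentTateDomain n K) (adeleAddChar K)
              (invQuot (AdelicGroupData.gl n K) (smoothedForm η
                ((P.1.toContRep (GLn.ofFinite n K Tf⁻¹)
                  ⟨S i₀ (x : E), ContRepresentation.ClosedSubrep.mem_toSubmodule.2 ((hS i₀).1.1 (x : E))⟩ :
                    P.1.toSubmodule) : (AdelicGroupData.gl n K).L2 μ')))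
              (GLn.ofFinite n K Tf * g))
            (fun g => (star (whittakerCoeff ν₀ (unipotentTateDomain n K) (adeleAddChar K)
              (invQuot (AdelicGroupData.gl n K) (smoothedForm η
                ((Q.1.toContRep (GLn.ofFinite n K Tf⁻¹)
                  ⟨S' j₀ (x' : E'), ContRepresentation.ClosedSubrep.mem_toSubmodule.2 ((hS' j₀).1.1 (x' : E'))⟩ :
                    Q.1.toSubmodule) : (AdelicGroupData.gl n K).L2 μ')))))
              (GLn.ofFinite n K Tf * g))
            (standardTestFun n K Φinf) s p ∂(νA.prod νK) =
        archRankinSelbergPairIntegral hcpt τ hτc τ' hτc'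
          (transferMap (whittakerFunctional ν₀ (continuous_adeleAddChar K)
            (ContRepresentation.Equiv.refl P.1.toContRep)) hτc
            ⟨S i₀, mem_multiplicityModule_of_mem_archIntertwinersLevel hUo hUc (hS i₀)⟩)
          (transferMap (whittakerFunctional ν₀ (continuous_adeleAddChar K)
            (ContRepresentation.Equiv.refl Q.1.toContRep)) hτc'
            ⟨S' j₀, mem_multiplicityModule_of_mem_archIntertwinersLevel hUo hUc (hS' j₀)⟩)
          x x' Φinf
          (((νA.restrict (unitBox (Set.univ : Set (HeightOneSpectrum (𝓞 K))))).map (archTorusOfIdele n K)))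
          (νK.map (kinfOfMaximalCompact n K)) s := by
  classical
  set f₁ : P.1.toSubmodule :=
    ⟨S i₀ (x : E), ContRepresentation.ClosedSubrep.mem_toSubmodule.2 ((hS i₀).1.1 (x : E))⟩ with hf₁
  set f₁' : Q.1.toSubmodule :=
    ⟨S' j₀ (x' : E'), ContRepresentation.ClosedSubrep.mem_toSubmodule.2 ((hS' j₀).1.1 (x' : E'))⟩ with hf₁'
  set f : P.1.toSubmodule := P.1.toContRep (GLn.ofFinite n K Tf⁻¹) f₁ with hf
  set f' : Q.1.toSubmodule := Q.1.toContRep (GLn.ofFinite n K Tf⁻¹) f₁' with hf'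
  have hUl := glIntegralLevel_mem_finiteLevels (n := n) (K := K) hcpt
  have hfin₁ := finiteDimensional_span_toContRep_ofK_of_mem_archIntertwiners P (hS i₀).1 (x : E) hxfin
  have hfin₁' := finiteDimensional_span_toContRep_ofK_of_mem_archIntertwiners Q (hS' j₀).1 (x' : E') hx'fin
  have hfin : FiniteDimensional ℂ (Submodule.span ℂ (Set.range
      fun κ : (AutomorphyDatum.gl n K hcpt).arch.maximalCompact => P.1.toContRep ((AutomorphyDatum.gl n K hcpt).ofK κ) f)) :=
    finiteDimensional_span_toContRep_ofK_toContRep_ofFinite P Tf⁻¹ f₁ hfin₁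
  have hfin' : FiniteDimensional ℂ (Submodule.span ℂ (Set.range
      fun κ : (AutomorphyDatum.gl n K hcpt).arch.maximalCompact => Q.1.toContRep ((AutomorphyDatum.gl n K hcpt).ofK κ) f')) :=
    finiteDimensional_span_toContRep_ofK_toContRep_ofFinite Q Tf⁻¹ f₁' hfin₁'
  have hUf : ∀ u ∈ glIntegralLevel n K, P.1.toContRep u f = f := hSfix i₀ (x : E)
  have hUf' : ∀ u ∈ glIntegralLevel n K, Q.1.toContRep u f' = f' := hS'fix j₀ (x' : E')
  obtain ⟨η, hη, hηU, hfix, hfix'⟩ :=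
    exists_testFunctionGL_smoothedVector_eq_pair hcpt P Q hPQ hUl f f' hfin hfin' hUf hUf'
  have hηK := left_invariant_principalCongruenceLevel_top_of_glIntegralLevel hηU
  refine ⟨η, hη, hηK, fun {Φinf} hΦ s => ?_⟩
  -- `R(T) R(η) f = R(T) f = S_{i₀} x`
  have hmulP : ∀ (a b : GL (Fin n) (AdeleRing (𝓞 K) K)) (y : P.1.toSubmodule),
      P.1.toContRep (a * b) y = P.1.toContRep a (P.1.toContRep b y) := fun a b y =>
    (DFunLike.congr_fun (map_mul P.1.toContRep a b) y).trans rfl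
  have hmulQ : ∀ (a b : GL (Fin n) (AdeleRing (𝓞 K) K)) (y : Q.1.toSubmodule),
      Q.1.toContRep (a * b) y = Q.1.toContRep a (Q.1.toContRep b y) := fun a b y =>
    (DFunLike.congr_fun (map_mul Q.1.toContRep a b) y).trans rfl
  have h1P : ∀ y : P.1.toSubmodule, P.1.toContRep 1 y = y := fun y =>
    (DFunLike.congr_fun (map_one P.1.toContRep) y).trans rfl
  have h1Q : ∀ y : Q.1.toSubmodule, Q.1.toContRep 1 y = y := fun y =>
    (DFunLike.congr_fun (map_one Q.1.toContRep) y).trans rfl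
  have hTf : P.1.toContRep (GLn.ofFinite n K Tf) (smoothedVector P.1 η f) = f₁ := by
    rw [hfix, hf, ← hmulP, ← map_mul, mul_inv_cancel, map_one]
    exact h1P f₁
  have hTf' : Q.1.toContRep (GLn.ofFinite n K Tf) (smoothedVector Q.1 η f') = f₁' := by
    rw [hfix', hf', ← hmulQ, ← map_mul, mul_inv_cancel, map_one]
    exact h1Q f₁'
  -- the single-constituent families
  set e : Fin k → archGardingSpace hcpt τ := fun i => if i = i₀ then x else 0 with he_def
  set e' : Fin k' → archGardingSpace hcpt τ' := fun j => if j = j₀ then x' else 0 with he'_def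
  have he : ∀ i, (e i : E) = ContinuousLinearMap.adjoint (S i)
      ((P.1.toContRep (GLn.ofFinite n K Tf) (smoothedVector P.1 η f) : P.1.toSubmodule) :
        (AdelicGroupData.gl n K).L2 μ') := fun i => by
    rw [hTf]
    change (e i : E) = ContinuousLinearMap.adjoint (S i) (S i₀ (x : E))
    rw [adjoint_apply_eq_schurCoeff_smul hτu hτi (hS i₀).1 (hS i).1, hSon]
    by_cases hi : i = i₀
    · simp [he_def, hi]
    · simp [he_def, hi, Ne.symm hi]
  have he' : ∀ j, (e' j : E') = ContinuousLinearMap.adjoint (S' j)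
      ((Q.1.toContRep (GLn.ofFinite n K Tf) (smoothedVector Q.1 η f') : Q.1.toSubmodule) :
        (AdelicGroupData.gl n K).L2 μ') := fun j => by
    rw [hTf']
    change (e' j : E') = ContinuousLinearMap.adjoint (S' j) (S' j₀ (x' : E'))
    rw [adjoint_apply_eq_schurCoeff_smul hτu' hτi' (hS' j₀).1 (hS' j).1, hSon']
    by_cases hj : j = j₀
    · simp [he'_def, hj]
    · simp [he'_def, hj, Ne.symm hj]
  have he0 : ∀ i, i ≠ i₀ → e i = 0 := fun i hi => by simp [he_def, hi]
  have he0' : ∀ j, j ≠ j₀ → e' j = 0 := fun j hj => by simp [he'_def, hj]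
  have hei : e i₀ = x := by simp [he_def]
  have hej : e' j₀ = x' := by simp [he'_def]
  haveI := locallyCompactSpace_ideleGroup K
  haveI : CompactSpace ↥(maximalCompactAdelic n K) :=
    isCompact_iff_compactSpace.1 (isCompact_maximalCompactAdelic n K)
  haveI : SigmaFinite νA := inferInstance
  haveI : IsFiniteMeasure νK := inferInstance
  have h := setIntegral_unitBox_univ_torusPairIntegrandC_whittakerCoeff_translate_eq_archRankinSelbergPairIntegral hcpt P Q
    hτu hτi hτc hex hUo hUc Tf hTU hS hSon hspan hτu' hτi' hτc' hex' hS' hSon' hspan' ν₀ hη hη hηK hηK f f' e he e' he'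
    he0 he0' hΦ s νA νK
  rw [hei, hej] at h
  exact h

set_option maxHeartbeats 1600000 in
/-- **Mœglin–Waldspurger (i)(b) for everywhere-unramified level-one pairs over ANY number field, from the
archimedean local theory** (main). Under the archimedean hypothesis `hX` of
`exists_entire_eq_partialPairL_of_levelOne_of_archPairLFactorData`, for `0 < n`, multiplicity one on
`L²_cusp`, ANY number field `K`, and cuspidal `π ≠ σ̄` on `GL_n(𝔸_K)` having non-zero `K(1)`-fixed Hecke
eigenvectors with Satake parameters `α₀ v`, `β₀ v` at EVERY finite place, `L^S(s, π × σ) = partialPairL S α β s`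
extends from `re s > 1` to an entire function for every finite `S` and all Satake families `α`, `β` off `S`.
Proof: as the source theorem, translating by the torus `τ` of Whittaker shifts (`exists_whittakerShiftTorus`):
the global side is `exists_entire_eq_partialPairL_of_localData_translate` (`S'_i = ∅`, `𝔫_i = 1`,
`c_i = 1`, `B = Λ`), the decompositions are those of the level-`T_f GL_n(𝒪̂) T_f⁻¹` pieces, the non-zero
functionals come from `exists_transferMap_ne_zero_of_levelOne_translate`, and the archimedean data of `hX`
are realised by `exists_testFunctionGL_setIntegral_unitBox_translate_eq_archRankinSelbergPairIntegral`.
[cite: MoeglinWaldspurger1989, Appendice, Corollaire (i)(b), p. 667] [cite: CogdellAnalyticTheory2004, §3.1–§3.2 and §4.1–§4.2] -/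
theorem exists_entire_eq_partialPairL_of_levelOne_of_archPairLFactorData'
    (hX : ∀ (hcpt : isCompact_glFiniteIntegralLevel n K)
      (E : Type) [NormedAddCommGroup E] [InnerProductSpace ℂ E] [CompleteSpace E]
      (τ : ContRepresentation ℂ (AutomorphyDatum.gl n K hcpt).arch.carrier E) (hτ : τ.IsStronglyContinuous)
      (_ : τ.IsUnitary) (_ : τ.IsTopIrreducible)
      (ℓ : archGardingSpace hcpt τ →ₗ[ℂ] ℂ) (_ : IsArchContWhittakerFunctional hcpt τ hτ ℓ) (_ : ℓ ≠ 0)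
      (E' : Type) [NormedAddCommGroup E'] [InnerProductSpace ℂ E'] [CompleteSpace E']
      (τ' : ContRepresentation ℂ (AutomorphyDatum.gl n K hcpt).arch.carrier E') (hτ' : τ'.IsStronglyContinuous)
      (_ : τ'.IsUnitary) (_ : τ'.IsTopIrreducible)
      (ℓ' : archGardingSpace hcpt τ' →ₗ[ℂ] ℂ) (_ : IsArchContWhittakerFunctional hcpt τ' hτ' ℓ') (_ : ℓ' ≠ 0)
      [MeasurableSpace (GL (Fin n) (mixedSpace K))] [BorelSpace (GL (Fin n) (mixedSpace K))]
      [MeasurableSpace ((mixedSpace K)ˣ)] [BorelSpace ((mixedSpace K)ˣ)]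
      (μA : Measure (Fin n → (mixedSpace K)ˣ)) (_ : IsHaarMeasure μA)
      (μK : Measure ↥(Kinf n K)) (_ : IsHaarMeasure μK),
      ∃ (m : ℕ) (e : Fin m → archGardingSpace hcpt τ) (e' : Fin m → archGardingSpace hcpt τ')
        (_ : ∀ i, FiniteDimensional ℂ (Submodule.span ℂ (Set.range
          fun κ : (AutomorphyDatum.gl n K hcpt).arch.maximalCompact => τ (toArch hcpt (κ : GL (Fin n) (mixedSpace K))) (e i : E))))
        (_ : ∀ i, FiniteDimensional ℂ (Submodule.span ℂ (Set.range
          fun κ : (AutomorphyDatum.gl n K hcpt).arch.maximalCompact => τ' (toArch hcpt (κ : GL (Fin n) (mixedSpace K))) (e' i : E'))))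
        (Φinf : Fin m → (Fin n → InfiniteAdeleRing K) → ℝ) (_ : ∀ i, Continuous (Φinf i))
        (_ : ∀ i z, 0 ≤ Φinf i z)
        (_ : ∀ i, ∃ Ψ : SchwartzMap (Fin n → mixedSpace K) ℂ, ∀ z : Fin n → InfiniteAdeleRing K,
          ((Φinf i z : ℝ) : ℂ) = Ψ fun j => InfiniteAdeleRing.ringEquiv_mixedSpace K (z j))
        (Λ : ℂ → ℂ), Differentiable ℂ Λ ∧ ∀ s : ℂ, 1 < s.re →
          Λ s * ∑ i, archRankinSelbergPairIntegral hcpt τ hτ τ' hτ' ℓ ℓ' (e i) (e' i) (Φinf i) μA μK s = 1)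
    (νI : Measure (ideleGroup K)) [νI.IsHaarMeasure]
    (νA : Measure (Fin n → ideleGroup K)) [IsHaarMeasure νA]
    (νK : Measure ↥(maximalCompactAdelic n K)) [IsHaarMeasure νK]
    (ν₀ : Measure ↥(adelicUnipotent n K)) [IsHaarMeasure ν₀]
    (hn : 0 < n) (h₁ : multiplicity_one_gl n K μ')
    (P P' : CuspidalAutomorphicRepGL n K μ') (hne : P ≠ P'.conj)
    {α₀ β₀ : SatakeFamily K}
    (hP : ∀ v : HeightOneSpectrum (𝓞 K), ∃ ϖ : (v.adicCompletion K)ˣ,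
      HasSatakeParameterAt P.1 (glIntegralLevel n K) v ϖ (α₀ v))
    (hP' : ∀ v : HeightOneSpectrum (𝓞 K), ∃ ϖ : (v.adicCompletion K)ˣ,
      HasSatakeParameterAt P'.1 (glIntegralLevel n K) v ϖ (β₀ v))
    {T : Set (HeightOneSpectrum (𝓞 K))} (hT : T.Finite) {α β : SatakeFamily K}
    (hα : IsSatakeFamilyOf P T α) (hβ : IsSatakeFamilyOf P' T β) :
    ∃ g : ℂ → ℂ, Differentiable ℂ g ∧ ∀ s : ℂ, 1 < s.re → g s = partialPairL T α β s := by
  classical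
  have hcpt : isCompact_glFiniteIntegralLevel n K := isCompact_glFiniteIntegralLevel_holds n K
  -- Satake families off `∅`; reduce to `S₀ = ∅`
  have hα₀ : IsSatakeFamilyOf P ∅ α₀ := IsSatakeFamilyOf.of_glIntegralLevel fun v _ => hP v
  have hβ₀ : IsSatakeFamilyOf P' ∅ β₀ := IsSatakeFamilyOf.of_glIntegralLevel fun v _ => hP' v
  refine exists_entire_eq_partialPairL_of_ramified_datum P P' (S₀ := ∅) (fun v hv => hv.elim) hα₀ hβ₀ ?_ hT hα hβ
  have hQ : ∀ v : HeightOneSpectrum (𝓞 K), ∃ ϖ : (v.adicCompletion K)ˣ,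
      HasSatakeParameterAt P'.conj.1 (glIntegralLevel n K) v ϖ ((β₀ v).map conj) := fun v => by
    obtain ⟨ϖ, h⟩ := hP' v
    exact ⟨ϖ, h.conj⟩
  -- the torus of Whittaker shifts, the finite-adelic translation and the conjugate level
  obtain ⟨τf, hτlast, hτψ⟩ := exists_whittakerShiftTorus n K
  set τA : Fin n → ideleGroup K := fun i =>
    Units.map (MonoidHom.inr (InfiniteAdeleRing K) (FiniteAdeleRing (𝓞 K) K) :
      FiniteAdeleRing (𝓞 K) K →* AdeleRing (𝓞 K) K) (τf i) with hτA
  set Tf : GL (Fin n) (FiniteAdeleRing (𝓞 K) K) := glDiagonal n (FiniteAdeleRing (𝓞 K) K) τf with hTf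
  have hD : glDiagonal n (AdeleRing (𝓞 K) K) τA = GLn.ofFinite n K Tf := glDiagonal_unitsMap_inr_eq_ofFinite τf
  obtain ⟨hUo, hUc, hTU⟩ := conjLevel_isOpen_isCompact hcpt Tf
  -- the archimedean components of `π` and `σ̄` and the level-`U_T` decompositions
  obtain ⟨E, _, _, _, τ, hτi, hτu, hτc, hex, hdec⟩ := exists_archComponent_decomposition (hcpt := hcpt) P
  obtain ⟨k, Sx, hSx, hSon, hspan, -⟩ := hdec _ hUo hUc
  obtain ⟨E', _, _, _, τ', hτi', hτu', hτc', hex', hdec'⟩ := exists_archComponent_decomposition (hcpt := hcpt) P'.conj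
  obtain ⟨k', Sy, hSy, hSon', hspan', -⟩ := hdec' _ hUo hUc
  -- non-zero transferred Whittaker functionals
  obtain ⟨i₀, hi₀⟩ := exists_transferMap_ne_zero_of_levelOne_translate hcpt hn P hP hτu hτi hτc hex τf hτψ hUo hUc hTU
    hSx hSon hspan ν₀
  obtain ⟨j₀, hj₀⟩ := exists_transferMap_ne_zero_of_levelOne_translate hcpt hn P'.conj hQ hτu' hτi' hτc' hex' τf hτψ
    hUo hUc hTU hSy hSon' hspan' ν₀
  have hℓ : IsContWhittakerFunctional P.1 (adeleAddChar K)
      (whittakerFunctional ν₀ (continuous_adeleAddChar K) (ContRepresentation.Equiv.refl P.1.toContRep)) :=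
    isContWhittakerFunctional_whittakerFunctional ν₀ (continuous_adeleAddChar K) (isGlobalAddChar_adeleAddChar K) _
  have hℓ' : IsContWhittakerFunctional P'.conj.1 (adeleAddChar K)
      (whittakerFunctional ν₀ (continuous_adeleAddChar K) (ContRepresentation.Equiv.refl P'.conj.1.toContRep)) :=
    isContWhittakerFunctional_whittakerFunctional ν₀ (continuous_adeleAddChar K) (isGlobalAddChar_adeleAddChar K) _
  have hℓi : IsArchContWhittakerFunctional hcpt τ hτc
      (transferMap (whittakerFunctional ν₀ (continuous_adeleAddChar K)
        (ContRepresentation.Equiv.refl P.1.toContRep)) hτc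
        ⟨Sx i₀, mem_multiplicityModule_of_mem_archIntertwinersLevel hUo hUc (hSx i₀)⟩) :=
    transferMap_mem_archContWhittakerFunctionals hℓ hτc _
  have hℓj : IsArchContWhittakerFunctional hcpt τ' hτc'
      (transferMap (whittakerFunctional ν₀ (continuous_adeleAddChar K)
        (ContRepresentation.Equiv.refl P'.conj.1.toContRep)) hτc'
        ⟨Sy j₀, mem_multiplicityModule_of_mem_archIntertwinersLevel hUo hUc (hSy j₀)⟩) :=
    transferMap_mem_archContWhittakerFunctionals hℓ' hτc' _
  -- the archimedean data, for the image Haar measures on `(K_∞ˣ)ⁿ` and `K_∞`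
  haveI := locallyCompactSpace_ideleGroup K
  obtain ⟨m, e, e', hefin, he'fin, Φinf, hΦc, hΦ0, hΦS, Λ, hΛ, hsum⟩ :=
    hX hcpt E τ hτc hτu hτi _ hℓi hi₀ E' τ' hτc' hτu' hτi' _ hℓj hj₀
      ((νA.restrict (unitBox (Set.univ : Set (HeightOneSpectrum (𝓞 K))))).map (archTorusOfIdele n K))
      (isHaarMeasure_map_archTorusOfIdele νA) (νK.map (kinfOfMaximalCompact n K))
      (isHaarMeasure_map_kinfOfMaximalCompact νK)
  -- realise every datum by a global level-one pair with one test function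
  have hPQ : P.1.toSubmodule ⟂ P'.conj.1.toSubmodule := CuspidalAutomorphicRepGL.isOrtho_of_ne h₁ hne
  have hSfix := fun i (y : E) => toContRep_ofFinite_inv_apply_eq_self_of_mem_archIntertwinersLevel_conj P Tf (hSx i) y
  have hS'fix := fun j (y : E') => toContRep_ofFinite_inv_apply_eq_self_of_mem_archIntertwinersLevel_conj P'.conj Tf (hSy j) y
  choose η hη hηK hA using fun i : Fin m =>
    exists_testFunctionGL_setIntegral_unitBox_translate_eq_archRankinSelbergPairIntegral hcpt P P'.conj hPQ hτu hτi hτc hex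
      Tf hUo hUc hTU hSx hSon hspan hSfix hτu' hτi' hτc' hex' hSy hSon' hspan' hS'fix ν₀ i₀ j₀ (e i) (e' i) (hefin i)
      (he'fin i) νA νK
  -- enumerations of the Satake parameters at every place
  have hxs : ∀ v : HeightOneSpectrum (𝓞 K), ∃ xv : Fin n → ℂ, (Finset.univ : Finset (Fin n)).val.map xv = α₀ v :=
    fun v => exists_univ_val_map_eq (hα₀.card_eq (Set.notMem_empty v))
  have hys : ∀ v : HeightOneSpectrum (𝓞 K), ∃ yv : Fin n → ℂ,
      (Finset.univ : Finset (Fin n)).val.map yv = (β₀ v).map conj := fun v =>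
    exists_univ_val_map_eq (by rw [Multiset.card_map]; exact hβ₀.card_eq (Set.notMem_empty v))
  choose xs hxs' using hxs
  choose ys hys' using hys
  -- the translated local data of the pair
  have hfinS : ∀ _ : Fin m, ((∅ : Set (HeightOneSpectrum (𝓞 K))) \ ∅).Finite := fun _ => by simp
  refine exists_entire_eq_partialPairL_of_localData_translate νI νA νK ν₀ hn h₁ P P' hne hα₀ hβ₀ (fun _ => (1 : ℂ))
    (fun i => P.1.toContRep (GLn.ofFinite n K Tf⁻¹)
      ⟨Sx i₀ (e i : E), ContRepresentation.ClosedSubrep.mem_toSubmodule.2 ((hSx i₀).1.1 (e i : E))⟩)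
    (fun i => P'.conj.1.toContRep (GLn.ofFinite n K Tf⁻¹)
      ⟨Sy j₀ (e' i : E'), ContRepresentation.ClosedSubrep.mem_toSubmodule.2 ((hSy j₀).1.1 (e' i : E'))⟩)
    (𝔫₀ := fun _ => ⊤) (fun _ => top_ne_bot) hη hηK (S' := fun _ => ∅) hfinS (fun _ => Set.empty_subset _)
    (fun _ v _ => not_asIdeal_dvd_top v) τA hτlast (fun _ v _ => hτψ v)
    (x := fun _ v => xs v) (y := fun _ v => ys v) (fun _ v _ => hxs' v) (fun _ v _ => hys' v) hΦc hΦ0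
    (fun i => ?_) hΛ fun s hs1 _ => ?_
  · obtain ⟨Ψ, hΨ⟩ := hΦS i
    exact ofReal_standardTestFun_mem_piSchwartzBruhat hΨ
  · -- `Λ(s) · Σ_i 1 · (1 · A^τ_i(s)) = Λ(s) Σ_i Ψ_∞,i(s) = 1`
    have htoF : ∀ i : Fin m, (hfinS i).toFinset = ∅ := fun i => by
      rw [Set.Finite.toFinset_eq_empty]
      simp
    have huniv : {v : HeightOneSpectrum (𝓞 K) | v ∉ (∅ : Set (HeightOneSpectrum (𝓞 K)))} = Set.univ := by
      ext v
      simp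
    rw [hD]
    have hterm : ∀ i : Fin m, (1 : ℂ) * ((∏ v ∈ (hfinS i).toFinset,
        (satakePairPolynomial (α₀ v) (β₀ v)).eval ((v.residueCard : ℂ) ^ (-s))) *
        ∫ p in unitBox {v : HeightOneSpectrum (𝓞 K) | v ∉ (∅ : Set (HeightOneSpectrum (𝓞 K)))} ×ˢ Set.univ,
          torusPairIntegrandC n K
            (fun g => whittakerCoeff ν₀ (unipotentTateDomain n K) (adeleAddChar K)
              (invQuot (AdelicGroupData.gl n K) (smoothedForm (η i)
                ((P.1.toContRep (GLn.ofFinite n K Tf⁻¹)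
                  ⟨Sx i₀ (e i : E), ContRepresentation.ClosedSubrep.mem_toSubmodule.2 ((hSx i₀).1.1 (e i : E))⟩ :
                    P.1.toSubmodule) : (AdelicGroupData.gl n K).L2 μ')))
              (GLn.ofFinite n K Tf * g))
            (fun g => (star (whittakerCoeff ν₀ (unipotentTateDomain n K) (adeleAddChar K)
              (invQuot (AdelicGroupData.gl n K) (smoothedForm (η i)
                ((P'.conj.1.toContRep (GLn.ofFinite n K Tf⁻¹)
                  ⟨Sy j₀ (e' i : E'), ContRepresentation.ClosedSubrep.mem_toSubmodule.2 ((hSy j₀).1.1 (e' i : E'))⟩ :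
                    P'.conj.1.toSubmodule) : (AdelicGroupData.gl n K).L2 μ')))))
              (GLn.ofFinite n K Tf * g))
            (standardTestFun n K (Φinf i)) s p ∂(νA.prod νK)) =
        archRankinSelbergPairIntegral hcpt τ hτc τ' hτc'
          (transferMap (whittakerFunctional ν₀ (continuous_adeleAddChar K)
            (ContRepresentation.Equiv.refl P.1.toContRep)) hτc
            ⟨Sx i₀, mem_multiplicityModule_of_mem_archIntertwinersLevel hUo hUc (hSx i₀)⟩)
          (transferMap (whittakerFunctional ν₀ (continuous_adeleAddChar K)
            (ContRepresentation.Equiv.refl P'.conj.1.toContRep)) hτc'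
            ⟨Sy j₀, mem_multiplicityModule_of_mem_archIntertwinersLevel hUo hUc (hSy j₀)⟩)
          (e i) (e' i) (Φinf i)
          (((νA.restrict (unitBox (Set.univ : Set (HeightOneSpectrum (𝓞 K))))).map (archTorusOfIdele n K)))
          (νK.map (kinfOfMaximalCompact n K)) s := by
      intro i
      have hprod : (∏ v ∈ (hfinS i).toFinset,
          (satakePairPolynomial (α₀ v) (β₀ v)).eval ((v.residueCard : ℂ) ^ (-s))) = 1 := by
        rw [htoF i, Finset.prod_empty]
      have hI := congrArg (fun G : Set (HeightOneSpectrum (𝓞 K)) =>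
        ∫ p in unitBox G ×ˢ (Set.univ : Set ↥(maximalCompactAdelic n K)), torusPairIntegrandC n K
          (fun g => whittakerCoeff ν₀ (unipotentTateDomain n K) (adeleAddChar K)
            (invQuot (AdelicGroupData.gl n K) (smoothedForm (η i)
              ((P.1.toContRep (GLn.ofFinite n K Tf⁻¹)
                ⟨Sx i₀ (e i : E), ContRepresentation.ClosedSubrep.mem_toSubmodule.2 ((hSx i₀).1.1 (e i : E))⟩ :
                  P.1.toSubmodule) : (AdelicGroupData.gl n K).L2 μ')))
            (GLn.ofFinite n K Tf * g))
          (fun g => (star (whittakerCoeff ν₀ (unipotentTateDomain n K) (adeleAddChar K)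
            (invQuot (AdelicGroupData.gl n K) (smoothedForm (η i)
              ((P'.conj.1.toContRep (GLn.ofFinite n K Tf⁻¹)
                ⟨Sy j₀ (e' i : E'), ContRepresentation.ClosedSubrep.mem_toSubmodule.2 ((hSy j₀).1.1 (e' i : E'))⟩ :
                  P'.conj.1.toSubmodule) : (AdelicGroupData.gl n K).L2 μ')))))
            (GLn.ofFinite n K Tf * g))
          (standardTestFun n K (Φinf i)) s p ∂(νA.prod νK)) huniv
      exact (one_mul _).trans ((congrArg₂ (· * ·) hprod hI).trans ((one_mul _).trans (hA i (hΦc i) s)))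
    exact (congrArg (fun z : ℂ => Λ s * z) (Finset.sum_congr rfl fun i _ => hterm i)).trans (hsum s hs1)

end Main

end Literature.NumberTheory.Automorphic
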